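import Summits.PneNP.GCT.Max.DetKYLeadingTermsTwoFast
import HarnessLib
import HarnessLib.Audit

/-!
# `GCT/Max`: the inclusion–exclusion RECURSION behind the histogram mirror of `LT2_σ(n,p,k)` — bit vectors, histogram vectors and
# the meaning of `ieRec` (cell `pub-gct-max`, track F; theory-2 memo `FINDINGS-LT2.md` §4, W2b; companion `Max/DetKYLeadingTermsTwoHist.lean`)

The kernel mirror of the leading-label count `LT2` (`Max/DetKYLeadingTermsTwoHist.lean`) enumerates, for each pair `(I',J')` of label
rows/columns, the nonempty families `C` of the `(k+1)²` witnesses and records `(−1)^{|C|+1}` at the histogram index `a_C = |⋂_{w∈C} A_w|`.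
This module is the generic, `Finset`-free part of that device, with its meaning PROVED:

* `bits f M` — the popcount of the low `f` bits of `M : ℕ` by peeling binary digits (`bits_eq_card`); `bitSet N M` — the set of low set bits;
* histogram vectors `List ℤ` read through `vget` (`vzero`, `vbump`, `vadd`; `vget_vbump`, `vget_vadd`);
* `ieRec N wm ws M s st` — process the witness list `ws`: skip a witness, or `&&&` its mask `wm w` into the running mask `M` (flipping the sign,
  setting the flag); at the end record the sign at index `bits N M`.  **Meaning** (`vget_ieRec`, for duplicate-free `ws`):
  `vget (ieRec N wm ws M s st) a = [st ∧ |bitSet N M| = a]·s + Σ_{∅≠C⊆ws} [capCount M C = a]·s·(−1)^{|C|}` with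
  `capCount M C = |{i ∈ bitSet N M : ∀ w ∈ C, bit i of wm w}|` — inclusion–exclusion unrolled one witness at a time (`Finset.sum_powerset_insert`).

PACKAGED (PROVED): `IERecMeaning`.  HONEST FRAMING: elementary bookkeeping (bit vectors and a subset recursion) for an evaluation device of the
cell's own bound `LT2`; nothing here bears on dc(per_m), VP vs VNP or P vs NP. Theory-2 gen 28. [folklore]
-/

open Finset

namespace Summit.PneNP.GCT

open Literature.Computability.AlgebraicComplexity Literature.Barriers.ValiantsHypothesis

namespace DetKYLeadingTermsTwo

open DetKYLeadingTerms (vpos)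

/-! ## Bit vectors as naturals -/

/-- Popcount of the low `f` bits of `M` (peeling the binary digits: `M % 2 + bits (M / 2)`; kernel-cheap). [folklore] -/
def bits : ℕ → ℕ → ℕ
  | 0, _ => 0
  | f + 1, M => M % 2 + bits f (M / 2)

/-- `bits f M = #{i < f : bit i of M}`. [folklore] -/
theorem bits_eq_card (f M : ℕ) : bits f M = ((range f).filter fun i => M.testBit i).card := by
  induction f generalizing M with
  | zero => simp [bits]
  | succ f ih =>
    rw [bits, ih, card_filter, card_filter, sum_range_succ']
    simp only [Nat.testBit_add_one, Nat.testBit_zero, decide_eq_true_eq]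
    rcases Nat.mod_two_eq_zero_or_one M with h | h <;> simp [h, add_comm]

/-- The set of low bits of a mask. [folklore] -/
def bitSet (N M : ℕ) : Finset ℕ := (range N).filter fun i => M.testBit i

/-- `bits N M = |bitSet N M|`. [folklore] -/
theorem bits_eq_card_bitSet (N M : ℕ) : bits N M = (bitSet N M).card := bits_eq_card N M

/-- `|bitSet N M| ≤ N`. [folklore] -/
theorem card_bitSet_le (N M : ℕ) : (bitSet N M).card ≤ N :=
  (card_filter_le _ _).trans (by rw [card_range])

/-- `bitSet` of an `&&&` is the filter. [folklore] -/
theorem bitSet_and (N M W : ℕ) : bitSet N (M &&& W) = (bitSet N M).filter fun i => W.testBit i := by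
  ext i
  simp only [bitSet, mem_filter, mem_range, Nat.testBit_and, Bool.and_eq_true]
  tauto

/-! ## Histogram vectors (lists of integers read through `vget`; out of range reads `0`) -/

/-- The zero vector of length `L`. [folklore] -/
def vzero : ℕ → List ℤ
  | 0 => []
  | L + 1 => 0 :: vzero L

/-- The vector of length `L` with `s` at index `b` (and `0` elsewhere). [folklore] -/
def vbump : ℕ → ℕ → ℤ → List ℤ
  | 0, _, _ => []
  | L + 1, 0, s => s :: vzero L
  | L + 1, b + 1, s => 0 :: vbump L b s

/-- Pointwise sum (the longer tail is kept). [folklore] -/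
def vadd : List ℤ → List ℤ → List ℤ
  | [], v => v
  | x :: u, [] => x :: u
  | x :: u, y :: v => (x + y) :: vadd u v

/-- Entry `a` (default `0`). [folklore] -/
def vget : List ℤ → ℕ → ℤ
  | [], _ => 0
  | x :: _, 0 => x
  | _ :: u, a + 1 => vget u a

/-- `vget (vzero L) a = 0`. [folklore] -/
@[simp] theorem vget_vzero (L a : ℕ) : vget (vzero L) a = 0 := by
  induction L generalizing a with
  | zero => cases a <;> rfl
  | succ L ih => cases a with
    | zero => rfl
    | succ a => exact ih a

/-- `vget (vbump L b s) a = [a = b] s` for `b < L`. [folklore] -/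
theorem vget_vbump (L b : ℕ) (s : ℤ) (a : ℕ) (hb : b < L) : vget (vbump L b s) a = if a = b then s else 0 := by
  induction L generalizing a b with
  | zero => omega
  | succ L ih =>
    cases b with
    | zero => cases a with
      | zero => rfl
      | succ a => simp [vbump, vget]
    | succ b => cases a with
      | zero => simp [vbump, vget]
      | succ a =>
        simp only [vbump, vget]
        rw [ih b a (by omega)]
        simp

/-- `vget` is additive under `vadd`. [folklore] -/
@[simp] theorem vget_vadd (u v : List ℤ) (a : ℕ) : vget (vadd u v) a = vget u a + vget v a := by
  induction u generalizing v a with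
  | nil => simp [vadd, vget]
  | cons x u ih =>
    cases v with
    | nil => cases a <;> simp [vadd, vget]
    | cons y v => cases a with
      | zero => simp [vadd, vget]
      | succ a => simp only [vadd, vget]; exact ih v a

/-! ## The inclusion–exclusion recursion over a witness list -/

section IERec

variable {α : Type*} (N : ℕ) (wm : α → ℕ)

/-- `ieRec N wm ws M s st`: process the witnesses `ws` one by one, either skipping a witness or intersecting the running mask `M`
with its mask (flipping the sign `s` and setting the flag); at the end record `s` at index `popcount M` if the flag is set.
The result is the signed histogram of `|M ∩ ⋂_{w ∈ C} wm w|` over the nonempty sub-families `C` of `ws` (`vget_ieRec`). [folklore] -/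
def ieRec : List α → ℕ → ℤ → Bool → List ℤ
  | [], M, s, st => if st then vbump (N + 1) (bits N M) s else vzero (N + 1)
  | w :: ws, M, s, st => vadd (ieRec ws M s st) (ieRec ws (M &&& wm w) (-s) true)

variable [DecidableEq α]

/-- `|bitSet N M ∩ ⋂_{w∈C} bits(wm w)|`: the low bits of `M` that are set in every mask of the family `C`. [folklore] -/
def capCount (M : ℕ) (C : Finset α) : ℕ := ((bitSet N M).filter fun i => ∀ w ∈ C, (wm w).testBit i = true).card

/-- `capCount` after one more intersection. [folklore] -/
theorem capCount_and (M : ℕ) (w : α) (C : Finset α) :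
    capCount N wm M (insert w C) = capCount N wm (M &&& wm w) C := by
  unfold capCount
  rw [bitSet_and, filter_filter]
  congr 1
  ext i
  simp only [mem_filter, mem_insert, forall_eq_or_imp]

omit [DecidableEq α] in
/-- `capCount` of the empty family is `|bitSet N M|`. [folklore] -/
theorem capCount_empty (M : ℕ) : capCount N wm M (∅ : Finset α) = (bitSet N M).card := by
  unfold capCount
  rw [filter_true_of_mem fun i _ w' hw' => absurd hw' (notMem_empty w')]

/-- The summand recorded for a sub-family `C`: `s·(−1)^{|C|}` at the index `capCount M C`. [folklore] -/
def ieTerm (M : ℕ) (s : ℤ) (a : ℕ) (C : Finset α) : ℤ :=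
  if capCount N wm M C = a then s * (-1) ^ C.card else 0

omit [DecidableEq α] in
/-- Helper: the flag term. [folklore] -/
theorem vget_ieRec_nil (M : ℕ) (s : ℤ) (st : Bool) (a : ℕ) :
    vget (ieRec N wm [] M s st) a = if st = true ∧ (bitSet N M).card = a then s else 0 := by
  simp only [ieRec]
  by_cases hst : st = true
  · rw [hst, if_pos rfl, vget_vbump _ _ _ _ (by rw [bits_eq_card_bitSet]; exact Nat.lt_succ_of_le (card_bitSet_le N M)),
      bits_eq_card_bitSet]
    by_cases h : (bitSet N M).card = a
    · simp [h]
    · have h' : ¬ a = (bitSet N M).card := fun e => h e.symm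
      simp [h, h']
  · rw [Bool.not_eq_true] at hst
    subst hst
    simp

/-- **Meaning of the recursion.** For a duplicate-free witness list `ws`:
`vget (ieRec ws M s st) a = [st ∧ |bitSet M| = a]·s + Σ_{∅ ≠ C ⊆ ws} ieTerm M s a C`. [folklore] -/
theorem vget_ieRec (ws : List α) (hws : ws.Nodup) (M : ℕ) (s : ℤ) (st : Bool) (a : ℕ) :
    vget (ieRec N wm ws M s st) a =
      (if st = true ∧ (bitSet N M).card = a then s else 0) +
        ∑ C ∈ ws.toFinset.powerset.filter (fun C => C.Nonempty), ieTerm N wm M s a C := by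
  induction ws generalizing M s st with
  | nil =>
    rw [vget_ieRec_nil]
    have h0 : (([] : List α).toFinset.powerset.filter fun C => C.Nonempty) = ∅ := by
      ext C; simp
    rw [h0, sum_empty, add_zero]
  | cons w ws ih =>
    have hw : w ∉ ws := (List.nodup_cons.1 hws).1
    have hws' : ws.Nodup := (List.nodup_cons.1 hws).2
    have hwT : w ∉ ws.toFinset := fun h => hw (List.mem_toFinset.1 h)
    rw [ieRec, vget_vadd, ih hws' M s st, ih hws' (M &&& wm w) (-s) true, List.toFinset_cons]
    -- split the sum over sub-families of `insert w T` into those avoiding `w` and those containing `w`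
    set T := ws.toFinset with hT
    have hsplit : ∑ C ∈ (insert w T).powerset.filter (fun C => C.Nonempty), ieTerm N wm M s a C =
        (∑ C ∈ T.powerset.filter (fun C => C.Nonempty), ieTerm N wm M s a C) +
          ∑ C ∈ T.powerset, ieTerm N wm M s a (insert w C) := by
      have key := sum_powerset_insert hwT (fun C => if C.Nonempty then ieTerm N wm M s a C else 0)
      rw [← sum_filter, ← sum_filter] at key
      rw [key]
      congr 1
      exact sum_congr rfl fun C _ => if_pos (insert_nonempty w C)
    rw [hsplit]
    -- the families containing `w`: the empty rest gives the flag term of the second call, the others its sum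
    have hone : ∀ C ∈ T.powerset, ieTerm N wm M s a (insert w C) = ieTerm N wm (M &&& wm w) (-s) a C := by
      intro C hC
      have hwC : w ∉ C := fun h => hwT (mem_powerset.1 hC h)
      simp only [ieTerm, capCount_and N wm M w C, card_insert_of_notMem hwC, pow_succ]
      split_ifs <;> ring
    rw [sum_congr rfl hone, ← Finset.sum_filter_add_sum_filter_not T.powerset (fun C => C.Nonempty)]
    have hempty : (T.powerset.filter fun C => ¬ C.Nonempty) = {∅} := by
      ext C
      simp only [mem_filter, mem_powerset, not_nonempty_iff_eq_empty, mem_singleton]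
      constructor
      · exact fun h => h.2
      · rintro rfl; exact ⟨empty_subset _, rfl⟩
    rw [hempty, sum_singleton]
    have hflag : ieTerm N wm (M &&& wm w) (-s) a ∅ = if (bitSet N (M &&& wm w)).card = a then -s else 0 := by
      rw [ieTerm, capCount_empty, card_empty, pow_zero, mul_one]
    rw [hflag]
    simp only [true_and]
    ring

end IERec

/-! ### Kernel sanity: three witnesses with masks `0b0111`, `0b1011`, `0b1101` on `N = 4` bits. -/

example : ieRec 4 (fun i : ℕ => 15 - 2 ^ i) [0, 1, 2] 15 (-1) false = [0, 1, -3, 3, 0] := by decide +kernel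

end DetKYLeadingTermsTwo

/-! ## The packaged statement of this module (PROVED) -/

/-- `GCT/Max` support **IERecMeaning** — the meaning of the inclusion–exclusion recursion: for every type of witnesses `α` (with decidable
equality), masks `wm : α → ℕ`, duplicate-free witness list `ws`, running mask `M`, sign `s`, flag `st` and index `a`,
`vget (ieRec N wm ws M s st) a = [st ∧ |bitSet N M| = a]·s + Σ_{∅ ≠ C ⊆ ws} ieTerm N wm M s a C`.  A statement of the cell, PROVED below. [folklore] -/
def IERecMeaning : Prop :=
  ∀ (α : Type) [DecidableEq α] (N : ℕ) (wm : α → ℕ) (ws : List α) (M : ℕ) (s : ℤ) (st : Bool) (a : ℕ), ws.Nodup →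
    DetKYLeadingTermsTwo.vget (DetKYLeadingTermsTwo.ieRec N wm ws M s st) a =
      (if st = true ∧ (DetKYLeadingTermsTwo.bitSet N M).card = a then s else 0) +
        ∑ C ∈ ws.toFinset.powerset.filter (fun C => C.Nonempty), DetKYLeadingTermsTwo.ieTerm N wm M s a C

/-- `IERecMeaning` holds. [folklore] -/
theorem ieRecMeaning_holds : IERecMeaning :=
  fun _ _ N wm ws M s st a hws => DetKYLeadingTermsTwo.vget_ieRec N wm ws hws M s st a

end Summit.PneNP.GCT
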